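import Summits.NavierStokesRegularity.NavierStokesRegularity.Theorems.SqueezeCycleRecurrentLiouvilleSatelliteSplit
import Summits.NavierStokesRegularity.NavierStokesRegularity.Theorems.SqueezeCycleRecurrentLiouvilleHullNoSatellitesOfApex
import Summits.NavierStokesRegularity.NavierStokesRegularity.Theorems.SqueezeCycleRecurrentLiouvilleRadiatingResidual
import HarnessLib

/-!
# Crux `RecurrentLiouville` (stmt-NavierStokesRegularity-1589), line `Sketch` — the residue of the line

Theorems-only file (no definitions, no named facts); `--supports` helper (lead c4) for the skeleton
`Cruxes/RecurrentLiouville/Lines/Sketch.lean`, whose only open registered stubs are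
S1a `stub_satHullNoSatellites` (hull satellite-freeness, ∃-form) and S2 `stub_satRadiatingLiouville`
(Type-I Liouville for radiating recurrent apex-class profiles).  Both are identified here with
propositions about APEX-CLASS TYPE-I LIOUVILLE (AL) — "no suitable weak solution on `ℝ³ × ℝ₋` with
weak gradient, `𝐈 < ⊤` and the apex bound `‖u(t,x)‖ ≤ C/(‖x‖ + √(−t))` is singular at the origin",
which is letter for letter the open target `Theses.RellichScar.NoApexTypeIProfile` of route
RellichScar (item stmt-NavierStokesRegularity-11716, the KNSS (1.6) form of "no Type-I profile"):

* `satResidue_hullNoSatellites_of_bridge` (with `satSP_recurrentLiouville_of_split`, lead c2):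
  **S1a ↔ (AL → RecurrentLiouville)**.  (⇒) is the split `stub_satSplitTools` (lead c2).  (⇐) by
  cases on AL: under AL the bridge gives the crux, of which S1a is a consequence
  (`stub_satSplitTools`); under ¬AL a singular apex-class profile exists, the decayed recurrent
  reduction (inside `satRR_apexLiouville_of_radiating`'s sibling `stub_satDecayedReduction`) makes it
  uniformly recurrent with the same constant, and a recurrent singular apex-class profile witnesses
  the conclusion of S1a outright (`satHullNoSatellites_of_apexProfile`: apex ⇒ satellite-free hull).
* **S2 ↔ AL** (`satRR_apexLiouville_of_radiating`, `satRR_radiating_of_apexLiouville`, lead c2;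
  assembled in `stub_satResidueTools`).

Hence the residue of line `Sketch` is exactly {AL, AL → crux}: S2 promotes to item 11716, and S1a is
precisely the gap between Type-I Liouville in the KNSS apex class and in the Albritton–Barker class
(a Type-I singularity model with the time rate only must be upgraded to one with space–time decay —
local-to-global decay, open).  Registered tools stub: `stub_satResidueTools` (the conjunction).

## References

* G. Koch, N. Nadirashvili, G. Seregin, V. Šverák, Acta Math. 203 (2009), (1.6). [KNSS2009]
* D. Albritton, T. Barker, J. Math. Fluid Mech. 21 (2019) = arXiv:1811.00502, Thm. 1.1, §3.
  [AlbrittonBarker2019]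
-/

noncomputable section

-- the sub-problem namespace repeats the summit name (D-0017 layout `Summit.<S>.<P>.Theorems`)
set_option linter.dupNamespace false

namespace Summit.NavierStokesRegularity.NavierStokesRegularity.Theorems

open MeasureTheory Set Function Filter Topology TopologicalSpace Metric
open Literature.Analysis.FluidPDE
open scoped NNReal ENNReal RealInnerProductSpace

/-! ## S1a from the bridge `AL → crux` -/

/-- **S1a from the bridge.**  If apex-class Type-I Liouville implies the crux, then hull
satellite-freeness S1a holds: under AL the crux holds and S1a follows from it (`stub_satSplitTools`);
under ¬AL there is a singular apex-class profile, the decayed recurrent reduction makes it uniformly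
recurrent (`stub_satDecayedReduction`), and a recurrent singular apex-class profile has a
satellite-free hull (`satHullNoSatellites_of_apexProfile`), which is the conclusion of S1a.
[cite: AlbrittonBarker2019, Thm. 1.1 and §3] [cite: KNSS2009, (1.6)] -/
theorem satResidue_hullNoSatellites_of_bridge
    (hbridge : (∀ (u : ℝ → EuclideanSpace ℝ (Fin 3) → EuclideanSpace ℝ (Fin 3))
      (p : ℝ → EuclideanSpace ℝ (Fin 3) → ℝ)
      (G : ℝ → EuclideanSpace ℝ (Fin 3) → EuclideanSpace ℝ (Fin 3) →L[ℝ] EuclideanSpace ℝ (Fin 3)) (C : ℝ),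
      IsSuitableWeakSolutionOn (slab (EuclideanSpace ℝ (Fin 3)) (Iio 0) isOpen_Iio) 1 0 u p →
      HasWeakSpatialGradientOn (slab (EuclideanSpace ℝ (Fin 3)) (Iio 0) isOpen_Iio) u G →
      typeIBound (Iio (0 : ℝ) ×ˢ univ) u p G < ⊤ → HasTypeIDecay C u →
      ¬ IsBackwardSingularPoint u 0) → Theses.SqueezeCycle.RecurrentLiouville) :
    (∃ (u : ℝ → EuclideanSpace ℝ (Fin 3) → EuclideanSpace ℝ (Fin 3))
      (p : ℝ → EuclideanSpace ℝ (Fin 3) → ℝ)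
      (G : ℝ → EuclideanSpace ℝ (Fin 3) → EuclideanSpace ℝ (Fin 3) →L[ℝ] EuclideanSpace ℝ (Fin 3)) (C : ℝ),
      IsSuitableWeakSolutionOn (slab (EuclideanSpace ℝ (Fin 3)) (Iio 0) isOpen_Iio) 1 0 u p ∧
      HasWeakSpatialGradientOn (slab (EuclideanSpace ℝ (Fin 3)) (Iio 0) isOpen_Iio) u G ∧
      typeIBound (Iio (0 : ℝ) ×ˢ univ) u p G < ⊤ ∧ HasTypeITimeDecay C u ∧
      IsScalingUniformlyRecurrent u ∧ IsBackwardSingularPoint u 0) →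
    ∃ (u : ℝ → EuclideanSpace ℝ (Fin 3) → EuclideanSpace ℝ (Fin 3))
      (p : ℝ → EuclideanSpace ℝ (Fin 3) → ℝ)
      (G : ℝ → EuclideanSpace ℝ (Fin 3) → EuclideanSpace ℝ (Fin 3) →L[ℝ] EuclideanSpace ℝ (Fin 3)) (C : ℝ),
      IsSuitableWeakSolutionOn (slab (EuclideanSpace ℝ (Fin 3)) (Iio 0) isOpen_Iio) 1 0 u p ∧
      HasWeakSpatialGradientOn (slab (EuclideanSpace ℝ (Fin 3)) (Iio 0) isOpen_Iio) u G ∧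
      typeIBound (Iio (0 : ℝ) ×ˢ univ) u p G < ⊤ ∧ HasTypeITimeDecay C u ∧
      IsScalingUniformlyRecurrent u ∧ IsBackwardSingularPoint u 0 ∧
      ∀ (c : ℕ → ℝ) (v : ℝ → EuclideanSpace ℝ (Fin 3) → EuclideanSpace ℝ (Fin 3))
        (q : ℝ → EuclideanSpace ℝ (Fin 3) → ℝ)
        (H : ℝ → EuclideanSpace ℝ (Fin 3) → EuclideanSpace ℝ (Fin 3) →L[ℝ] EuclideanSpace ℝ (Fin 3)),
        (∀ n, 0 < c n) →
        IsSuitableWeakSolutionOn (slab (EuclideanSpace ℝ (Fin 3)) (Iio 0) isOpen_Iio) 1 0 v q →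
        HasWeakSpatialGradientOn (slab (EuclideanSpace ℝ (Fin 3)) (Iio 0) isOpen_Iio) v H →
        typeIBound (Iio (0 : ℝ) ×ˢ univ) v q H < ⊤ → HasTypeITimeDecay C v →
        IsBackwardSingularPoint v 0 →
        (∀ R : ℝ, 0 < R → Tendsto (fun n => eLpNorm (uncurry (nsRescale (c n) u) - uncurry v) 3
          (volume.restrict (parabolicCylinder R (0 : ℝ × EuclideanSpace ℝ (Fin 3))))) atTop (𝓝 0)) →
        ∀ x : EuclideanSpace ℝ (Fin 3), x ≠ 0 → ¬ IsBackwardSingularPoint v (0, x) := by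
  by_cases hAL : ∀ (u : ℝ → EuclideanSpace ℝ (Fin 3) → EuclideanSpace ℝ (Fin 3))
      (p : ℝ → EuclideanSpace ℝ (Fin 3) → ℝ)
      (G : ℝ → EuclideanSpace ℝ (Fin 3) → EuclideanSpace ℝ (Fin 3) →L[ℝ] EuclideanSpace ℝ (Fin 3)) (C : ℝ),
      IsSuitableWeakSolutionOn (slab (EuclideanSpace ℝ (Fin 3)) (Iio 0) isOpen_Iio) 1 0 u p →
      HasWeakSpatialGradientOn (slab (EuclideanSpace ℝ (Fin 3)) (Iio 0) isOpen_Iio) u G →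
      typeIBound (Iio (0 : ℝ) ×ˢ univ) u p G < ⊤ → HasTypeIDecay C u →
      ¬ IsBackwardSingularPoint u 0
  · -- AL: the crux holds, and S1a is one half of its split
    exact (stub_satSplitTools.1 (hbridge hAL)).1
  · -- ¬AL: a singular apex-class profile exists; make it recurrent (S3) and read off S1a's conclusion
    intro _
    push Not at hAL
    obtain ⟨u, p, G, C, hsw, hwg, hI, hdec, hsing⟩ := hAL
    obtain ⟨w, q, H, hsw', hwg', hI', hdec', hsing', hrec'⟩ :=
      stub_satDecayedReduction u p G C hsw hwg hI hdec hsing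
    exact satHullNoSatellites_of_apexProfile ⟨w, q, H, C, hsw', hwg', hI', hdec', hrec', hsing'⟩

/-! ## Registered tools stub: the residue of line `Sketch` -/

/-- **Registered tools stub `stub_satResidueTools`** (crux stmt-NavierStokesRegularity-1589, line
`Sketch`, lead c4): the two open registered stubs of the skeleton are propositions about apex-class
Type-I Liouville AL (verbatim the open item stmt-NavierStokesRegularity-11716
`Theses.RellichScar.NoApexTypeIProfile`): **S1a `stub_satHullNoSatellites` ↔ (AL → RecurrentLiouville)**
and **S2 `stub_satRadiatingLiouville` ↔ AL**.  So the line reduces the crux to nothing cheaper than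
{AL, AL → crux}. [cite: KNSS2009, (1.6)] [cite: AlbrittonBarker2019, Thm. 1.1 and §3] -/
theorem stub_satResidueTools :
    (((∃ (u : ℝ → EuclideanSpace ℝ (Fin 3) → EuclideanSpace ℝ (Fin 3))
        (p : ℝ → EuclideanSpace ℝ (Fin 3) → ℝ)
        (G : ℝ → EuclideanSpace ℝ (Fin 3) → EuclideanSpace ℝ (Fin 3) →L[ℝ] EuclideanSpace ℝ (Fin 3)) (C : ℝ),
        IsSuitableWeakSolutionOn (slab (EuclideanSpace ℝ (Fin 3)) (Iio 0) isOpen_Iio) 1 0 u p ∧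
        HasWeakSpatialGradientOn (slab (EuclideanSpace ℝ (Fin 3)) (Iio 0) isOpen_Iio) u G ∧
        typeIBound (Iio (0 : ℝ) ×ˢ univ) u p G < ⊤ ∧ HasTypeITimeDecay C u ∧
        IsScalingUniformlyRecurrent u ∧ IsBackwardSingularPoint u 0) →
      ∃ (u : ℝ → EuclideanSpace ℝ (Fin 3) → EuclideanSpace ℝ (Fin 3))
        (p : ℝ → EuclideanSpace ℝ (Fin 3) → ℝ)
        (G : ℝ → EuclideanSpace ℝ (Fin 3) → EuclideanSpace ℝ (Fin 3) →L[ℝ] EuclideanSpace ℝ (Fin 3)) (C : ℝ),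
        IsSuitableWeakSolutionOn (slab (EuclideanSpace ℝ (Fin 3)) (Iio 0) isOpen_Iio) 1 0 u p ∧
        HasWeakSpatialGradientOn (slab (EuclideanSpace ℝ (Fin 3)) (Iio 0) isOpen_Iio) u G ∧
        typeIBound (Iio (0 : ℝ) ×ˢ univ) u p G < ⊤ ∧ HasTypeITimeDecay C u ∧
        IsScalingUniformlyRecurrent u ∧ IsBackwardSingularPoint u 0 ∧
        ∀ (c : ℕ → ℝ) (v : ℝ → EuclideanSpace ℝ (Fin 3) → EuclideanSpace ℝ (Fin 3))
          (q : ℝ → EuclideanSpace ℝ (Fin 3) → ℝ)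
          (H : ℝ → EuclideanSpace ℝ (Fin 3) → EuclideanSpace ℝ (Fin 3) →L[ℝ] EuclideanSpace ℝ (Fin 3)),
          (∀ n, 0 < c n) →
          IsSuitableWeakSolutionOn (slab (EuclideanSpace ℝ (Fin 3)) (Iio 0) isOpen_Iio) 1 0 v q →
          HasWeakSpatialGradientOn (slab (EuclideanSpace ℝ (Fin 3)) (Iio 0) isOpen_Iio) v H →
          typeIBound (Iio (0 : ℝ) ×ˢ univ) v q H < ⊤ → HasTypeITimeDecay C v →
          IsBackwardSingularPoint v 0 →
          (∀ R : ℝ, 0 < R → Tendsto (fun n => eLpNorm (uncurry (nsRescale (c n) u) - uncurry v) 3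
            (volume.restrict (parabolicCylinder R (0 : ℝ × EuclideanSpace ℝ (Fin 3))))) atTop (𝓝 0)) →
          ∀ x : EuclideanSpace ℝ (Fin 3), x ≠ 0 → ¬ IsBackwardSingularPoint v (0, x)) ↔
      ((∀ (u : ℝ → EuclideanSpace ℝ (Fin 3) → EuclideanSpace ℝ (Fin 3))
        (p : ℝ → EuclideanSpace ℝ (Fin 3) → ℝ)
        (G : ℝ → EuclideanSpace ℝ (Fin 3) → EuclideanSpace ℝ (Fin 3) →L[ℝ] EuclideanSpace ℝ (Fin 3)) (C : ℝ),
        IsSuitableWeakSolutionOn (slab (EuclideanSpace ℝ (Fin 3)) (Iio 0) isOpen_Iio) 1 0 u p →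
        HasWeakSpatialGradientOn (slab (EuclideanSpace ℝ (Fin 3)) (Iio 0) isOpen_Iio) u G →
        typeIBound (Iio (0 : ℝ) ×ˢ univ) u p G < ⊤ → HasTypeIDecay C u →
        ¬ IsBackwardSingularPoint u 0) → Theses.SqueezeCycle.RecurrentLiouville)) ∧
    ((∀ (w : ℝ → EuclideanSpace ℝ (Fin 3) → EuclideanSpace ℝ (Fin 3))
        (q : ℝ → EuclideanSpace ℝ (Fin 3) → ℝ)
        (H : ℝ → EuclideanSpace ℝ (Fin 3) → EuclideanSpace ℝ (Fin 3) →L[ℝ] EuclideanSpace ℝ (Fin 3)) (C' : ℝ),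
        IsSuitableWeakSolutionOn (slab (EuclideanSpace ℝ (Fin 3)) (Iio 0) isOpen_Iio) 1 0 w q →
        HasWeakSpatialGradientOn (slab (EuclideanSpace ℝ (Fin 3)) (Iio 0) isOpen_Iio) w H →
        typeIBound (Iio (0 : ℝ) ×ˢ univ) w q H < ⊤ → HasTypeIDecay C' w →
        IsScalingUniformlyRecurrent w →
        (¬ ∃ R : ℝ, ∀ φ : EuclideanSpace ℝ (Fin 3) → EuclideanSpace ℝ (Fin 3),
          Literature.Analysis.FunctionSpaces.IsTestFunctionOn (⊤ : Opens (EuclideanSpace ℝ (Fin 3))) φ →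
          tsupport φ ⊆ (closedBall (0 : EuclideanSpace ℝ (Fin 3)) R)ᶜ →
          Tendsto (fun t => ∫ x, ⟪w t x, φ x⟫) (𝓝[<] (0 : ℝ)) (𝓝 0)) →
        ¬ IsBackwardSingularPoint w 0) ↔
      (∀ (u : ℝ → EuclideanSpace ℝ (Fin 3) → EuclideanSpace ℝ (Fin 3))
        (p : ℝ → EuclideanSpace ℝ (Fin 3) → ℝ)
        (G : ℝ → EuclideanSpace ℝ (Fin 3) → EuclideanSpace ℝ (Fin 3) →L[ℝ] EuclideanSpace ℝ (Fin 3)) (C : ℝ),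
        IsSuitableWeakSolutionOn (slab (EuclideanSpace ℝ (Fin 3)) (Iio 0) isOpen_Iio) 1 0 u p →
        HasWeakSpatialGradientOn (slab (EuclideanSpace ℝ (Fin 3)) (Iio 0) isOpen_Iio) u G →
        typeIBound (Iio (0 : ℝ) ×ˢ univ) u p G < ⊤ → HasTypeIDecay C u →
        ¬ IsBackwardSingularPoint u 0)) :=
  ⟨⟨fun hS1a hAL => satSP_recurrentLiouville_of_split hS1a hAL,
      fun hbridge => satResidue_hullNoSatellites_of_bridge hbridge⟩,
    ⟨fun hS2 => satRR_apexLiouville_of_radiating hS2, fun hAL => satRR_radiating_of_apexLiouville hAL⟩⟩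

end Summit.NavierStokesRegularity.NavierStokesRegularity.Theorems

end
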